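import Literature.RepresentationTheory.MoeglinVignerasWaldspurger1987.RankOneThetaLiftLinesEquivalent
import Literature.NumberTheory.GelbartRogawski1991.LocalUnitaryUndoubling
import Literature.NumberTheory.GelbartRogawski1991.LocalKudlaSplittingRigidity
import Literature.RepresentationTheory.HeisenbergGroup.MetaplecticBoxHom
import HarnessLib

/-!
# Undoubling commutes with the line-isometry conjugation

Topic `NumberTheory/GelbartRogawski1991`; namespace `Literature.NumberTheory.GelbartRogawski1991.UnitaryDualPair.LocalSplitting`
(that of `LocalUnitaryUndoubling`, `LocalKudlaSplittingRigidity`).  KERNEL ONLY: theorems; no definition, no named fact,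
no `sorry`.

Setting: `E/F` quadratic with `c`, a finite place `v`, TWO trace-zero elements `δ₁, δ₂` (`c δᵢ = -δᵢ ≠ 0`) and a unit
`x ∈ (E ⊗ F_v)ˣ` with `δ₂ ⊗ 1 = x · xᶜ · (δ₁ ⊗ 1)` (the two skew-hermitian lines `W_{ε₁}, W_{ε₂}` are isometric by `y ↦ x y`,
[Liu2021, App. D §D.1 Step 1]); `T₀ ∈ M_n(F)` symmetric with `det T₀` a unit, `J = T₀ ⊗ 1`, and the DOUBLED datum
`J^𝔻 = (T₀ ⊕ −T₀) ⊗ 1` (`gramD`).  The tree holds: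
* the LINE-ISOMETRY TRANSPORT `γ_x = reIm_{δ₂} ∘ (u ↦ x u) ∘ reIm_{δ₁}⁻¹ ∈ Sp(𝕎_v)` at every rank `N`
  (`LineTransport.transport` / `transportSp`, [MoeglinVignerasWaldspurger1987, Chap. 3 I.1–I.3]) with
  `ι_{δ₂}(g) = γ_x ι_{δ₁}(g) γ_x⁻¹` (`LineTransport.iota_eq_conj_iota`), a lift `q_x ∈ S̃p_{ψ_v}(𝕎_v)` and the transported
  splitting `lineTransportSplitting s₁ = q_x s₁ q_x⁻¹` (`RankOneThetaLiftLinesEquivalent`);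
* the UNDOUBLING `undoubleLoc s : U(J)(F_v) →* S̃p(𝕎_v)` of a homomorphism `s : H(F_v) = U(J^𝔻)(F_v) →* S̃p(𝕎^𝔻_v)`
  over `ι^𝔻` (`LocalUnitaryUndoubling`, [GelbartRogawski1991, §3.1 Prop. 3.1.1]).

This file proves that the two constructions COMMUTE — step F8a of the a4-liuD3 «⇐» closer (cell `hodgecm-mathlib`,
crux `stub_iso_of_params`, S6a «the `μ`-splitting is natural under the line isometry»):

* §1 the transport acts INDEX-WISE (`transport_glue`: on `𝕎^𝔻_v = 𝕎_v ⊕ 𝕎⁻_v` it is `γ_x ⊕ γ_x`), hence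
  **`transport_deltaLagrangian`** — at rank `n + n` it maps Kudla's Lagrangian `ℓ_Δ` (`deltaLagrangian`, pairs with equal
  halves) onto itself — and **`transportSp_gramD_eq_spInl_mul_spInr`** — `γ_x^𝔻 = (γ_x ⊕ 1)(1 ⊕ γ_x)` in
  `Sp(𝕎^𝔻_v)` (`spInl`, `spInr`; the second block read in `Sp(𝕎_{−T₀}) = Sp(𝕎_{T₀})`, `mem_symplecticGroup_gram_neg_iff`);
* §2 the lift `j̃(q_x, q̄_x)` of `γ_x^𝔻` to `S̃p_{ψ_v}(𝕎^𝔻_v)` (Kudla's `j̃`, `MpPsi.boxPair` / `MpPsi.conjHom`, read at the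
  local models: `proj_boxPair_gramD`, `toOp_boxPair_gramD`, `coe_proj_conjHom_localMp`, `toOp_conjHom_localMp`), whence
  **`implements_boxEquivSB_lineTransportOp`** — `M_x ⊠ M̄_x` implements `π(P)` for ANY `P` over `γ_x^𝔻` (such a `P`
  stabilises `ℓ_Δ`, `map_deltaLagrangian_eq_of_proj_eq_transportSp`; conjugating a homomorphism over `ι^𝔻_{δ₁}` by it gives
  one over `ι^𝔻_{δ₂}`, `LocalLineIsometryRigidity.proj_conj_comp_eq_iota`);
* §3 **`undoubleLoc_conj_eq_lineTransportSplitting`** — for `s` over `ι^𝔻_{δ₁}` and any `P ∈ S̃p_{ψ_v}(𝕎^𝔻_v)` over `γ_x^𝔻`: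
  `undoubleLoc (P s P⁻¹) = lineTransportSplitting x (undoubleLoc s)`.  Proof: conjugation by `P` depends on `P` only
  through an implementer of `π(P)` (`MpPsi.toRep_conj_eq_of_implements`, implementers are unique up to a scalar), so
  `M_x ⊠ M̄_x` serves; then `ω(P s(g ⊕ 1) P⁻¹)(f₁ ⊠ f₂) = (M_x ω(undoubleLoc s g) M_x⁻¹ f₁) ⊠ f₂` (`toRep_undoubleLoc_boxSB`,
  `boxEquivSB_boxSB`), and `⊠ f₂`-cancellation (`boxSB_left_cancel`) identifies the operators; the projections agree by
  `proj_undoubleLoc` / `proj_lineTransportSplitting`.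

## References
* [MoeglinVignerasWaldspurger1987] C. Mœglin, M.-F. Vignéras, J.-L. Waldspurger, LNM 1291 (1987), Chap. 2 II.1 (A)–(B),
  Rem. (6); Chap. 3 I.1–I.3.
* [GelbartRogawski1991] S. Gelbart, J. Rogawski, Invent. Math. 105 (1991), §3.1 Prop. 3.1.1 p. 455, Remark p. 457 L4–13.
* [Kudla1994] S. Kudla, Israel J. Math. 87 (1994), §3, Thm. 3.1.  [HarrisKudlaSweet1996] M. Harris, S. Kudla, W. Sweet,
  J. AMS 9 (1996), §1 (1.4), (1.11).
* [Liu2021] Y. Liu, Camb. J. Math. 9 (2021), App. D §D.1 Step 1 (l. 5217), Lem. D.1 (3) (l. 5233).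
-/

set_option autoImplicit false

noncomputable section

open NumberField IsDedekindDomain Matrix
open Literature.RepresentationTheory.HeisenbergGroup
open Literature.NumberTheory.Automorphic Literature.NumberTheory.Automorphic.UnitaryGroup Literature.NumberTheory.Weil1964
open Literature.RepresentationTheory.MoeglinVignerasWaldspurger1987
open Literature.RepresentationTheory.MoeglinVignerasWaldspurger1987.LineTransport

/-! ## §0 One generic identity: the inverse of `M₁ ⊠ M₂` on products -/

namespace Literature.RepresentationTheory.HeisenbergGroup

/-- `(M₁ ⊠ M₂)⁻¹ (f₁ ⊠ f₂) = M₁⁻¹ f₁ ⊠ M₂⁻¹ f₂`. [cite: MoeglinVignerasWaldspurger1987, Chap. 2 II.1 Rem. (6)] -/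
theorem boxEquivSB_symm_boxSB {K : Type*} [Field K] [ValuativeRel K] [TopologicalSpace K] [IsNonarchimedeanLocalField K]
    {ι₁ ι₂ ι : Type*} [Fintype ι₁] [Fintype ι₂] [Fintype ι] (e : ι₁ ⊕ ι₂ ≃ ι)
    (M₁ : SchwartzBruhat (ι₁ → K) ≃ₗ[ℂ] SchwartzBruhat (ι₁ → K)) (M₂ : SchwartzBruhat (ι₂ → K) ≃ₗ[ℂ] SchwartzBruhat (ι₂ → K))
    (f₁ : SchwartzBruhat (ι₁ → K)) (f₂ : SchwartzBruhat (ι₂ → K)) :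
    (boxEquivSB K e M₁ M₂).symm (boxSB K e f₁ f₂) = boxSB K e (M₁.symm f₁) (M₂.symm f₂) := by
  rw [LinearEquiv.symm_apply_eq, boxEquivSB_boxSB, LinearEquiv.apply_symm_apply, LinearEquiv.apply_symm_apply]

end Literature.RepresentationTheory.HeisenbergGroup

namespace Literature.NumberTheory.GelbartRogawski1991.UnitaryDualPair.LocalSplitting

variable (F : Type) [Field F] [NumberField F] (E : Type) [Field E] [NumberField E] [Algebra F E]
  [Algebra.IsQuadraticExtension F E] (c : E ≃ₐ[F] E) (v : HeightOneSpectrum (𝓞 F))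
  {δ₁ δ₂ : E} (hcδ₁ : c δ₁ = -δ₁) (hδ₁ : δ₁ ≠ 0) {d₁ : F} (hd₁ : δ₁ * δ₁ = algebraMap F E d₁)
  (hcδ₂ : c δ₂ = -δ₂) (hδ₂ : δ₂ ≠ 0) {d₂ : F} (hd₂ : δ₂ * δ₂ = algebraMap F E d₂)
  (x : (LocalRing E v)ˣ)

/-! ## §1 The transport acts index-wise: it preserves `ℓ_Δ` and is `γ_x ⊕ γ_x` on the doubled space -/

section IndexWise

/-- coordinates of the transport: `(γ_x p)_k = reIm_{δ₂} (x · reIm_{δ₁}⁻¹ (p_k))`, first component — the transport acts on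
each coordinate plane `(x_k, y_k)` by one and the same `F_v`-linear map. [cite: MoeglinVignerasWaldspurger1987, Chap. 3 I.1] -/
theorem transport_apply_fst (N : ℕ) (p : (Fin N → (v.adicCompletion F)) × (Fin N → (v.adicCompletion F))) (k : Fin N) :
    (transport E v c N hcδ₁ hδ₁ hd₁ hcδ₂ hδ₂ hd₂ x p).1 k =
      QuadraticCoordinates.re (quadraticLocalEquiv E v c hcδ₂ hδ₂).toLinearEquiv.toAddEquiv
        ((x : LocalRing E v) * (quadraticLocalEquiv E v c hcδ₁ hδ₁).toLinearEquiv.toAddEquiv (p.1 k, p.2 k)) := by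
  simp only [transport, LinearEquiv.trans_apply]
  rfl

/-- coordinates of the transport, second component. [cite: MoeglinVignerasWaldspurger1987, Chap. 3 I.1] -/
theorem transport_apply_snd (N : ℕ) (p : (Fin N → (v.adicCompletion F)) × (Fin N → (v.adicCompletion F))) (k : Fin N) :
    (transport E v c N hcδ₁ hδ₁ hd₁ hcδ₂ hδ₂ hd₂ x p).2 k =
      QuadraticCoordinates.im (quadraticLocalEquiv E v c hcδ₂ hδ₂).toLinearEquiv.toAddEquiv
        ((x : LocalRing E v) * (quadraticLocalEquiv E v c hcδ₁ hδ₁).toLinearEquiv.toAddEquiv (p.1 k, p.2 k)) := by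
  simp only [transport, LinearEquiv.trans_apply]
  rfl

/-- coordinates of the INVERSE transport: `(γ_x⁻¹ p)_k = reIm_{δ₁} (x⁻¹ · reIm_{δ₂}⁻¹ (p_k))`, first component.
[cite: MoeglinVignerasWaldspurger1987, Chap. 3 I.1] -/
theorem transport_symm_apply_fst (N : ℕ) (p : (Fin N → (v.adicCompletion F)) × (Fin N → (v.adicCompletion F))) (k : Fin N) :
    ((transport E v c N hcδ₁ hδ₁ hd₁ hcδ₂ hδ₂ hd₂ x).symm p).1 k =
      QuadraticCoordinates.re (quadraticLocalEquiv E v c hcδ₁ hδ₁).toLinearEquiv.toAddEquiv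
        (((x⁻¹ : (LocalRing E v)ˣ) : LocalRing E v) *
          (quadraticLocalEquiv E v c hcδ₂ hδ₂).toLinearEquiv.toAddEquiv (p.1 k, p.2 k)) := by
  simp only [transport, LinearEquiv.trans_symm, LinearEquiv.trans_apply, LinearEquiv.symm_symm]
  rfl

/-- coordinates of the inverse transport, second component. [cite: MoeglinVignerasWaldspurger1987, Chap. 3 I.1] -/
theorem transport_symm_apply_snd (N : ℕ) (p : (Fin N → (v.adicCompletion F)) × (Fin N → (v.adicCompletion F))) (k : Fin N) :
    ((transport E v c N hcδ₁ hδ₁ hd₁ hcδ₂ hδ₂ hd₂ x).symm p).2 k =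
      QuadraticCoordinates.im (quadraticLocalEquiv E v c hcδ₁ hδ₁).toLinearEquiv.toAddEquiv
        (((x⁻¹ : (LocalRing E v)ˣ) : LocalRing E v) *
          (quadraticLocalEquiv E v c hcδ₂ hδ₂).toLinearEquiv.toAddEquiv (p.1 k, p.2 k)) := by
  simp only [transport, LinearEquiv.trans_symm, LinearEquiv.trans_apply, LinearEquiv.symm_symm]
  rfl

variable (n : ℕ)

/-- **the transport of rank `n + n` is `γ_x ⊕ γ_x`**: on glued vectors `(a ⊔ a', b ⊔ b')` of `𝕎^𝔻_v = 𝕎_v ⊕ 𝕎⁻_v` (along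
`e₂`) it acts as the rank-`n` transport on each summand. [cite: MoeglinVignerasWaldspurger1987, Chap. 3 I.1–I.3] -/
theorem transport_glue (a b a' b' : Fin n → (v.adicCompletion F)) :
    transport E v c (n + n) hcδ₁ hδ₁ hd₁ hcδ₂ hδ₂ hd₂ x (glue (e₂ n) a a', glue (e₂ n) b b') =
      (glue (e₂ n) (transport E v c n hcδ₁ hδ₁ hd₁ hcδ₂ hδ₂ hd₂ x (a, b)).1
          (transport E v c n hcδ₁ hδ₁ hd₁ hcδ₂ hδ₂ hd₂ x (a', b')).1,
        glue (e₂ n) (transport E v c n hcδ₁ hδ₁ hd₁ hcδ₂ hδ₂ hd₂ x (a, b)).2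
          (transport E v c n hcδ₁ hδ₁ hd₁ hcδ₂ hδ₂ hd₂ x (a', b')).2) := by
  refine Prod.ext (funext fun k => ?_) (funext fun k => ?_)
  · obtain ⟨s, rfl⟩ := (e₂ n).surjective k
    rw [transport_apply_fst]
    rcases s with i | j
    · simp only [glue_apply_inl, transport_apply_fst]
    · simp only [glue_apply_inr, transport_apply_fst]
  · obtain ⟨s, rfl⟩ := (e₂ n).surjective k
    rw [transport_apply_snd]
    rcases s with i | j
    · simp only [glue_apply_inl, transport_apply_snd]
    · simp only [glue_apply_inr, transport_apply_snd]

/-- the transport of rank `n + n` preserves «equal halves»: it maps `ℓ_Δ` into `ℓ_Δ`. [cite: HarrisKudlaSweet1996, §1 (1.11)] -/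
theorem transport_mem_deltaLagrangian {p : (Fin (n + n) → (v.adicCompletion F)) × (Fin (n + n) → (v.adicCompletion F))} (hp : p ∈ deltaLagrangian F v n) :
    transport E v c (n + n) hcδ₁ hδ₁ hd₁ hcδ₂ hδ₂ hd₂ x p ∈ deltaLagrangian F v n := by
  intro i
  obtain ⟨h1, h2⟩ := hp i
  refine ⟨?_, ?_⟩
  · rw [transport_apply_fst, transport_apply_fst, h1, h2]
  · rw [transport_apply_snd, transport_apply_snd, h1, h2]

/-- the inverse transport of rank `n + n` maps `ℓ_Δ` into `ℓ_Δ`. [cite: HarrisKudlaSweet1996, §1 (1.11)] -/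
theorem transport_symm_mem_deltaLagrangian {p : (Fin (n + n) → (v.adicCompletion F)) × (Fin (n + n) → (v.adicCompletion F))}
    (hp : p ∈ deltaLagrangian F v n) :
    (transport E v c (n + n) hcδ₁ hδ₁ hd₁ hcδ₂ hδ₂ hd₂ x).symm p ∈ deltaLagrangian F v n := by
  intro i
  obtain ⟨h1, h2⟩ := hp i
  refine ⟨?_, ?_⟩
  · rw [transport_symm_apply_fst, transport_symm_apply_fst, h1, h2]
  · rw [transport_symm_apply_snd, transport_symm_apply_snd, h1, h2]

variable {T₀ : Matrix (Fin n) (Fin n) F}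

/-- **the line-isometry transport of the doubled datum stabilises Kudla's Lagrangian `ℓ_Δ`**:
`γ_x^𝔻 ℓ_Δ = ℓ_Δ` (both halves are moved by the same `γ_x`). [cite: HarrisKudlaSweet1996, §1 (1.11)] [cite: Kudla1994, §3] -/
theorem transport_deltaLagrangian (hT₀ : T₀.IsSymm) (hx : algebraMap E (LocalRing E v) δ₂ = (x : LocalRing E v) * conjLocal E c v x * algebraMap E (LocalRing E v) δ₁) :
    (deltaLagrangian F v n).map
        (toLin F v (transportSp E v c (n + n) hcδ₁ hδ₁ hd₁ hcδ₂ hδ₂ hd₂ x (gramD F n T₀) (gramD_isSymm F n hT₀) hx)) =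
      deltaLagrangian F v n := by
  refine le_antisymm (Submodule.map_le_iff_le_comap.2 fun p hp => ?_) fun p hp => ?_
  · exact transport_mem_deltaLagrangian F E c v hcδ₁ hδ₁ hd₁ hcδ₂ hδ₂ hd₂ x n hp
  · refine ⟨(transport E v c (n + n) hcδ₁ hδ₁ hd₁ hcδ₂ hδ₂ hd₂ x).symm p,
      transport_symm_mem_deltaLagrangian F E c v hcδ₁ hδ₁ hd₁ hcδ₂ hδ₂ hd₂ x n hp, ?_⟩
    exact (transport E v c (n + n) hcδ₁ hδ₁ hd₁ hcδ₂ hδ₂ hd₂ x).apply_symm_apply p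

/-- the rank-`n` transport read in `Sp(𝕎_{−T₀}) = Sp(𝕎_{T₀})` (same group, `mem_symplecticGroup_gram_neg_iff`).
[cite: MoeglinVignerasWaldspurger1987, Chap. 2 II Remarques (2)–(3)] -/
theorem transport_mem_symplecticGroup_neg (hT₀ : T₀.IsSymm) (hx : algebraMap E (LocalRing E v) δ₂ = (x : LocalRing E v) * conjLocal E c v x * algebraMap E (LocalRing E v) δ₁) :
    transport E v c n hcδ₁ hδ₁ hd₁ hcδ₂ hδ₂ hd₂ x ∈
      symplecticGroup (polar (Matrix.toLinearMap₂' (v.adicCompletion F) (-(localGram F n T₀ v)))) :=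
  (mem_symplecticGroup_gram_neg_iff (localGram F n T₀ v) _).2
    (transport_mem_localSp E v c n hcδ₁ hδ₁ hd₁ hcδ₂ hδ₂ hd₂ x T₀ hT₀ hx)

/-- **`γ_x^𝔻 = (γ_x ⊕ 1) · (1 ⊕ γ_x)` in `Sp(𝕎^𝔻_v)`**: the line-isometry transport of the doubled datum `T₀ ⊕ (−T₀)` is the
product of the two embedded rank-`n` transports (`spInl`, `spInr` along `e₂`; the second one read in `Sp(𝕎_{−T₀})`).
[cite: MoeglinVignerasWaldspurger1987, Chap. 2 II.1 Rem. (6); Chap. 3 I.1–I.3] [cite: Kudla1994, §3] -/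
theorem transportSp_gramD_eq_spInl_mul_spInr (hT₀ : T₀.IsSymm) (hx : algebraMap E (LocalRing E v) δ₂ = (x : LocalRing E v) * conjLocal E c v x * algebraMap E (LocalRing E v) δ₁) :
    transportSp E v c (n + n) hcδ₁ hδ₁ hd₁ hcδ₂ hδ₂ hd₂ x (gramD F n T₀) (gramD_isSymm F n hT₀) hx =
      spInl (e₂ n) (localGram F n T₀ v) (-(localGram F n T₀ v)) (localGram_gramD F v n T₀)
          (transportSp E v c n hcδ₁ hδ₁ hd₁ hcδ₂ hδ₂ hd₂ x T₀ hT₀ hx) *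
        spInr (e₂ n) (localGram F n T₀ v) (-(localGram F n T₀ v)) (localGram_gramD F v n T₀)
          ⟨transport E v c n hcδ₁ hδ₁ hd₁ hcδ₂ hδ₂ hd₂ x,
            transport_mem_symplecticGroup_neg F E c v hcδ₁ hδ₁ hd₁ hcδ₂ hδ₂ hd₂ x n hT₀ hx⟩ := by
  refine Subtype.ext (LinearEquiv.ext fun p => ?_)
  obtain ⟨p₁, p₂⟩ := p
  rw [coe_transportSp, Subgroup.coe_mul, LinearEquiv.mul_apply, coe_spInl, coe_spInr, coe_transportSp]
  conv_lhs => rw [← glue_resL_resR (e₂ n) p₁, ← glue_resL_resR (e₂ n) p₂]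
  rw [transport_glue, inrW_apply, inlW_apply_glue]

end IndexWise

/-! ## §2 Lifts of `γ_x^𝔻` and conjugation of a homomorphism over `ι^𝔻_{δ₁}` -/

section Lift

variable (n : ℕ) {T₀ : Matrix (Fin n) (Fin n) F}

/-- **Kudla's pair `j̃(p₁, p₂)` at the local Schrödinger models lies over `π(p₁) ⊕ π(p₂)`** (`MpPsi.proj_boxPair`, read at
`LocalMp F (n + n) (gramD F n T₀) v`). [cite: MoeglinVignerasWaldspurger1987, Chap. 2 II.1 Rem. (6)] -/
theorem proj_boxPair_gramD (p₁ : LocalMp F n T₀ v)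
    (p₂ : MpPsi (schrodingerSB (Matrix.toLinearMap₂' (v.adicCompletion F) (-(localGram F n T₀ v))) (adeleAddCharAt F v) (isLocallyConstant_of_isContinuousNontrivial (isContinuousNontrivial_adeleAddCharAt F v)) (continuous_toLinearMap₂'_left (-(localGram F n T₀ v))))) :
    MpPsi.proj (localSchrodinger F (n + n) (gramD F n T₀) v)
        (MpPsi.boxPair (e₂ n) (localGram F n T₀ v) (-(localGram F n T₀ v)) (localGram_gramD F v n T₀) (isLocallyConstant_of_isContinuousNontrivial (isContinuousNontrivial_adeleAddCharAt F v)) (continuous_toLinearMap₂'_left (localGram F n T₀ v)) (continuous_toLinearMap₂'_left (-(localGram F n T₀ v))) (continuous_toLinearMap₂'_left (localGram F (n + n) (gramD F n T₀) v)) p₁ p₂) =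
      spInl (e₂ n) (localGram F n T₀ v) (-(localGram F n T₀ v)) (localGram_gramD F v n T₀)
          (MpPsi.proj (localSchrodinger F n T₀ v) p₁) *
        spInr (e₂ n) (localGram F n T₀ v) (-(localGram F n T₀ v)) (localGram_gramD F v n T₀) (MpPsi.proj _ p₂) :=
  rfl

/-- **… and its operator is `op(p₁) ⊠ op(p₂)`** (`MpPsi.toOp_boxPair` at `LocalMp F (n + n) (gramD F n T₀) v`).
[cite: MoeglinVignerasWaldspurger1987, Chap. 2 II.1 Rem. (6)] -/
theorem toOp_boxPair_gramD (p₁ : LocalMp F n T₀ v)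
    (p₂ : MpPsi (schrodingerSB (Matrix.toLinearMap₂' (v.adicCompletion F) (-(localGram F n T₀ v))) (adeleAddCharAt F v) (isLocallyConstant_of_isContinuousNontrivial (isContinuousNontrivial_adeleAddCharAt F v)) (continuous_toLinearMap₂'_left (-(localGram F n T₀ v))))) :
    MpPsi.toOp (localSchrodinger F (n + n) (gramD F n T₀) v)
        (MpPsi.boxPair (e₂ n) (localGram F n T₀ v) (-(localGram F n T₀ v)) (localGram_gramD F v n T₀) (isLocallyConstant_of_isContinuousNontrivial (isContinuousNontrivial_adeleAddCharAt F v)) (continuous_toLinearMap₂'_left (localGram F n T₀ v)) (continuous_toLinearMap₂'_left (-(localGram F n T₀ v))) (continuous_toLinearMap₂'_left (localGram F (n + n) (gramD F n T₀) v)) p₁ p₂) =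
      boxEquivSB (v.adicCompletion F) (e₂ n) (MpPsi.toOp (localSchrodinger F n T₀ v) p₁) (MpPsi.toOp _ p₂) :=
  rfl

/-- the conjugate pair `q̄ = (π(q), M̄)` of `q ∈ S̃p_{ψ_v}(𝕎_{T₀})` lies over `π(q)` read in `Sp(𝕎_{−T₀})` (underlying
automorphisms). [cite: MoeglinVignerasWaldspurger1987, Chap. 2 II.1 (A); Chap. 4 II.1] -/
theorem coe_proj_conjHom_localMp (q : LocalMp F n T₀ v) :
    ((MpPsi.proj _ (MpPsi.conjHom (isLocallyConstant_of_isContinuousNontrivial (isContinuousNontrivial_adeleAddCharAt F v)) (localGram F n T₀ v) (continuous_toLinearMap₂'_left (localGram F n T₀ v)) (continuous_toLinearMap₂'_left (-(localGram F n T₀ v))) q) :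
        symplecticGroup (polar (Matrix.toLinearMap₂' (v.adicCompletion F) (-(localGram F n T₀ v))))) :
          ((Fin n → (v.adicCompletion F)) × (Fin n → (v.adicCompletion F))) ≃ₗ[(v.adicCompletion F)] ((Fin n → (v.adicCompletion F)) × (Fin n → (v.adicCompletion F)))) =
      (MpPsi.proj (localSchrodinger F n T₀ v) q : LocalSp F n T₀ v) :=
  MpPsi.coe_proj_conjHom (isLocallyConstant_of_isContinuousNontrivial (isContinuousNontrivial_adeleAddCharAt F v)) (localGram F n T₀ v) (continuous_toLinearMap₂'_left (localGram F n T₀ v)) (continuous_toLinearMap₂'_left (-(localGram F n T₀ v))) q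

/-- the operator of the conjugate pair is `conj ∘ op(q) ∘ conj`. [cite: MoeglinVignerasWaldspurger1987, Chap. 2 II.1 (A); Chap. 4 II.1] -/
theorem toOp_conjHom_localMp (q : LocalMp F n T₀ v) :
    MpPsi.toOp _ (MpPsi.conjHom (isLocallyConstant_of_isContinuousNontrivial (isContinuousNontrivial_adeleAddCharAt F v)) (localGram F n T₀ v) (continuous_toLinearMap₂'_left (localGram F n T₀ v)) (continuous_toLinearMap₂'_left (-(localGram F n T₀ v))) q) = conjOp (MpPsi.toOp (localSchrodinger F n T₀ v) q) :=
  rfl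

/-- **any `P ∈ S̃p_{ψ_v}(𝕎^𝔻_v)` over `γ_x^𝔻` stabilises `ℓ_Δ`** (the hypothesis `hP` of
`LocalLineIsometryRigidity.conj_comp_eq_of_parabolic`, from `transport_deltaLagrangian`). [cite: Kudla1994, §3] -/
theorem map_deltaLagrangian_eq_of_proj_eq_transportSp (hT₀ : T₀.IsSymm) (hx : algebraMap E (LocalRing E v) δ₂ = (x : LocalRing E v) * conjLocal E c v x * algebraMap E (LocalRing E v) δ₁)
    (P : LocalMp F (n + n) (gramD F n T₀) v)
    (hP : MpPsi.proj _ P = transportSp E v c (n + n) hcδ₁ hδ₁ hd₁ hcδ₂ hδ₂ hd₂ x (gramD F n T₀) (gramD_isSymm F n hT₀) hx) :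
    (deltaLagrangian F v n).map (toLin F v (MpPsi.proj _ P)) = deltaLagrangian F v n := by
  rw [hP]
  exact transport_deltaLagrangian F E c v hcδ₁ hδ₁ hd₁ hcδ₂ hδ₂ hd₂ x n hT₀ hx

/-- **`M_x ⊠ M̄_x` implements `π(P)` for ANY `P ∈ S̃p_{ψ_v}(𝕎^𝔻_v)` over `γ_x^𝔻`** — it is the operator of Kudla's pair
`j̃(q_x, q̄_x)` (the chosen lift `q_x = (γ_x, M_x)` and its conjugate), which lies over `(γ_x ⊕ 1)(1 ⊕ γ_x) = γ_x^𝔻 = π(P)`.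
[cite: MoeglinVignerasWaldspurger1987, Chap. 2 II.1 (A), Rem. (6)] [cite: Kudla1994, §3] -/
theorem implements_boxEquivSB_lineTransportOp (hT₀ : T₀.IsSymm) (hT₀d : IsUnit T₀.det) (hx : algebraMap E (LocalRing E v) δ₂ = (x : LocalRing E v) * conjLocal E c v x * algebraMap E (LocalRing E v) δ₁)
    (P : LocalMp F (n + n) (gramD F n T₀) v)
    (hP : MpPsi.proj _ P = transportSp E v c (n + n) hcδ₁ hδ₁ hd₁ hcδ₂ hδ₂ hd₂ x (gramD F n T₀) (gramD_isSymm F n hT₀) hx) :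
    Implements (localSchrodinger F (n + n) (gramD F n T₀) v) (ofSymplectic _ (MpPsi.proj _ P))
      (boxEquivSB (v.adicCompletion F) (e₂ n) (lineTransportOp E v c n hcδ₁ hδ₁ hd₁ hcδ₂ hδ₂ hd₂ x T₀ hT₀ hT₀d hx)
        (conjOp (lineTransportOp E v c n hcδ₁ hδ₁ hd₁ hcδ₂ hδ₂ hd₂ x T₀ hT₀ hT₀d hx))) := by
  -- Kudla's pair of the chosen lift `q_x` and of its conjugate
  have hq := proj_lineTransportLift E v c n hcδ₁ hδ₁ hd₁ hcδ₂ hδ₂ hd₂ x T₀ hT₀ hT₀d hx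
  have hq' : MpPsi.proj _ (MpPsi.conjHom (isLocallyConstant_of_isContinuousNontrivial (isContinuousNontrivial_adeleAddCharAt F v)) (localGram F n T₀ v) (continuous_toLinearMap₂'_left (localGram F n T₀ v)) (continuous_toLinearMap₂'_left (-(localGram F n T₀ v)))
        (lineTransportLift E v c n hcδ₁ hδ₁ hd₁ hcδ₂ hδ₂ hd₂ x T₀ hT₀ hT₀d hx)) =
      ⟨transport E v c n hcδ₁ hδ₁ hd₁ hcδ₂ hδ₂ hd₂ x,
        transport_mem_symplecticGroup_neg F E c v hcδ₁ hδ₁ hd₁ hcδ₂ hδ₂ hd₂ x n hT₀ hx⟩ :=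
    Subtype.ext ((coe_proj_conjHom_localMp F v n _).trans (congrArg Subtype.val hq))
  have hP₀ : MpPsi.proj (localSchrodinger F (n + n) (gramD F n T₀) v)
        (MpPsi.boxPair (e₂ n) (localGram F n T₀ v) (-(localGram F n T₀ v)) (localGram_gramD F v n T₀) (isLocallyConstant_of_isContinuousNontrivial (isContinuousNontrivial_adeleAddCharAt F v)) (continuous_toLinearMap₂'_left (localGram F n T₀ v)) (continuous_toLinearMap₂'_left (-(localGram F n T₀ v))) (continuous_toLinearMap₂'_left (localGram F (n + n) (gramD F n T₀) v))
          (lineTransportLift E v c n hcδ₁ hδ₁ hd₁ hcδ₂ hδ₂ hd₂ x T₀ hT₀ hT₀d hx)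
          (MpPsi.conjHom (isLocallyConstant_of_isContinuousNontrivial (isContinuousNontrivial_adeleAddCharAt F v)) (localGram F n T₀ v) (continuous_toLinearMap₂'_left (localGram F n T₀ v)) (continuous_toLinearMap₂'_left (-(localGram F n T₀ v)))
            (lineTransportLift E v c n hcδ₁ hδ₁ hd₁ hcδ₂ hδ₂ hd₂ x T₀ hT₀ hT₀d hx))) =
      MpPsi.proj _ P :=
    ((proj_boxPair_gramD F v n _ _).trans
      (congrArg₂ (fun a b => spInl (e₂ n) (localGram F n T₀ v) (-(localGram F n T₀ v)) (localGram_gramD F v n T₀) a *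
          spInr (e₂ n) (localGram F n T₀ v) (-(localGram F n T₀ v)) (localGram_gramD F v n T₀) b) hq hq')).trans
      ((transportSp_gramD_eq_spInl_mul_spInr F E c v hcδ₁ hδ₁ hd₁ hcδ₂ hδ₂ hd₂ x n hT₀ hx).symm.trans hP.symm)
  rw [← hP₀]
  exact MpPsi.toRep_implements (localSchrodinger F (n + n) (gramD F n T₀) v)
    (MpPsi.boxPair (e₂ n) (localGram F n T₀ v) (-(localGram F n T₀ v)) (localGram_gramD F v n T₀) (isLocallyConstant_of_isContinuousNontrivial (isContinuousNontrivial_adeleAddCharAt F v)) (continuous_toLinearMap₂'_left (localGram F n T₀ v)) (continuous_toLinearMap₂'_left (-(localGram F n T₀ v))) (continuous_toLinearMap₂'_left (localGram F (n + n) (gramD F n T₀) v))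
      (lineTransportLift E v c n hcδ₁ hδ₁ hd₁ hcδ₂ hδ₂ hd₂ x T₀ hT₀ hT₀d hx)
      (MpPsi.conjHom (isLocallyConstant_of_isContinuousNontrivial (isContinuousNontrivial_adeleAddCharAt F v)) (localGram F n T₀ v) (continuous_toLinearMap₂'_left (localGram F n T₀ v)) (continuous_toLinearMap₂'_left (-(localGram F n T₀ v))) (lineTransportLift E v c n hcδ₁ hδ₁ hd₁ hcδ₂ hδ₂ hd₂ x T₀ hT₀ hT₀d hx)))

end Lift

/-! ## §3 Undoubling commutes with the line-isometry conjugation -/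

section Main

variable (n : ℕ) {T₀ : Matrix (Fin n) (Fin n) F} {J : Matrix (Fin n) (Fin n) E} {JD : Matrix (Fin (n + n)) (Fin (n + n)) E}

set_option maxHeartbeats 400000 in
/-- **on products: `ω(P s(g ⊕ 1) P⁻¹)(f₁ ⊠ f₂) = (M_x ω(undoubleLoc s g) M_x⁻¹ f₁) ⊠ f₂`** for `s` over `ι^𝔻_{δ₁}` and ANY lift
`P` of `γ_x^𝔻` — conjugation by `P` is computed through the implementer `M_x ⊠ M̄_x` of `π(P)` (implementers are unique up to
a scalar). [cite: MoeglinVignerasWaldspurger1987, Chap. 2 II.1 (A), Rem. (6)] [cite: GelbartRogawski1991, §3.1 Prop. 3.1.1 p. 455] -/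
theorem toRep_conj_inlLoc_boxSB (hJ : J = T₀.map (algebraMap F E))
    (hJD : JD = (gramD F n T₀).map (algebraMap F E)) (hT₀ : T₀.IsSymm) (hT₀d : IsUnit T₀.det)
    (hx : algebraMap E (LocalRing E v) δ₂ = (x : LocalRing E v) * conjLocal E c v x * algebraMap E (LocalRing E v) δ₁)
    (s : UnitaryGroup.localPi E c (n + n) JD v →* LocalMp F (n + n) (gramD F n T₀) v)
    (hs : ∀ h, MpPsi.proj _ (s h) = iota F E c (n + n) hcδ₁ hδ₁ hd₁ (gramD F n T₀) (gramD_isSymm F n hT₀) hJD v h)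
    (P : LocalMp F (n + n) (gramD F n T₀) v)
    (hP : MpPsi.proj _ P = transportSp E v c (n + n) hcδ₁ hδ₁ hd₁ hcδ₂ hδ₂ hd₂ x (gramD F n T₀) (gramD_isSymm F n hT₀) hx)
    (g : UnitaryGroup.localPi E c n J v) (f₁ f₂ : SchwartzBruhat (Fin n → (v.adicCompletion F))) :
    MpPsi.toRep (localSchrodinger F (n + n) (gramD F n T₀) v)
        (((MulAut.conj P).toMonoidHom.comp s) (inlLoc F E c v n hJ hJD g)) (boxSB (v.adicCompletion F) (e₂ n) f₁ f₂) =
      boxSB (v.adicCompletion F) (e₂ n)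
        ((lineTransportOp E v c n hcδ₁ hδ₁ hd₁ hcδ₂ hδ₂ hd₂ x T₀ hT₀ hT₀d hx) (MpPsi.toRep (localSchrodinger F n T₀ v) (undoubleLoc F E c v n hJ hJD hcδ₁ hδ₁ hd₁ hT₀ hT₀d s hs g)
          ((lineTransportOp E v c n hcδ₁ hδ₁ hd₁ hcδ₂ hδ₂ hd₂ x T₀ hT₀ hT₀d hx).symm f₁))) f₂ := by
  have hU := implementerUniqueUpToScalar_localSchrodinger F (n + n) (gramD F n T₀) (isUnit_det_gramD F n hT₀d) v
  have hM := implements_boxEquivSB_lineTransportOp F E c v hcδ₁ hδ₁ hd₁ hcδ₂ hδ₂ hd₂ x n hT₀ hT₀d hx P hP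
  calc MpPsi.toRep (localSchrodinger F (n + n) (gramD F n T₀) v)
        (((MulAut.conj P).toMonoidHom.comp s) (inlLoc F E c v n hJ hJD g)) (boxSB (v.adicCompletion F) (e₂ n) f₁ f₂)
      = MpPsi.toRep (localSchrodinger F (n + n) (gramD F n T₀) v)
          (P * s (inlLoc F E c v n hJ hJD g) * P⁻¹) (boxSB (v.adicCompletion F) (e₂ n) f₁ f₂) := rfl
    _ = boxEquivSB (v.adicCompletion F) (e₂ n) (lineTransportOp E v c n hcδ₁ hδ₁ hd₁ hcδ₂ hδ₂ hd₂ x T₀ hT₀ hT₀d hx) (conjOp (lineTransportOp E v c n hcδ₁ hδ₁ hd₁ hcδ₂ hδ₂ hd₂ x T₀ hT₀ hT₀d hx))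
          (MpPsi.toRep (localSchrodinger F (n + n) (gramD F n T₀) v) (s (inlLoc F E c v n hJ hJD g))
            ((boxEquivSB (v.adicCompletion F) (e₂ n) (lineTransportOp E v c n hcδ₁ hδ₁ hd₁ hcδ₂ hδ₂ hd₂ x T₀ hT₀ hT₀d hx) (conjOp (lineTransportOp E v c n hcδ₁ hδ₁ hd₁ hcδ₂ hδ₂ hd₂ x T₀ hT₀ hT₀d hx))).symm (boxSB (v.adicCompletion F) (e₂ n) f₁ f₂))) :=
      MpPsi.toRep_conj_eq_of_implements _ hU P _ _ hM _
    _ = boxEquivSB (v.adicCompletion F) (e₂ n) (lineTransportOp E v c n hcδ₁ hδ₁ hd₁ hcδ₂ hδ₂ hd₂ x T₀ hT₀ hT₀d hx) (conjOp (lineTransportOp E v c n hcδ₁ hδ₁ hd₁ hcδ₂ hδ₂ hd₂ x T₀ hT₀ hT₀d hx))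
          (MpPsi.toRep (localSchrodinger F (n + n) (gramD F n T₀) v) (s (inlLoc F E c v n hJ hJD g))
            (boxSB (v.adicCompletion F) (e₂ n) ((lineTransportOp E v c n hcδ₁ hδ₁ hd₁ hcδ₂ hδ₂ hd₂ x T₀ hT₀ hT₀d hx).symm f₁) ((conjOp (lineTransportOp E v c n hcδ₁ hδ₁ hd₁ hcδ₂ hδ₂ hd₂ x T₀ hT₀ hT₀d hx)).symm f₂))) := by
      rw [boxEquivSB_symm_boxSB]
    _ = boxEquivSB (v.adicCompletion F) (e₂ n) (lineTransportOp E v c n hcδ₁ hδ₁ hd₁ hcδ₂ hδ₂ hd₂ x T₀ hT₀ hT₀d hx) (conjOp (lineTransportOp E v c n hcδ₁ hδ₁ hd₁ hcδ₂ hδ₂ hd₂ x T₀ hT₀ hT₀d hx))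
          (boxSB (v.adicCompletion F) (e₂ n) (MpPsi.toRep (localSchrodinger F n T₀ v)
            (undoubleLoc F E c v n hJ hJD hcδ₁ hδ₁ hd₁ hT₀ hT₀d s hs g) ((lineTransportOp E v c n hcδ₁ hδ₁ hd₁ hcδ₂ hδ₂ hd₂ x T₀ hT₀ hT₀d hx).symm f₁)) ((conjOp (lineTransportOp E v c n hcδ₁ hδ₁ hd₁ hcδ₂ hδ₂ hd₂ x T₀ hT₀ hT₀d hx)).symm f₂)) := by
      rw [toRep_undoubleLoc_boxSB F E c v n hJ hJD hcδ₁ hδ₁ hd₁ hT₀ hT₀d s hs g]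
    _ = boxSB (v.adicCompletion F) (e₂ n)
          ((lineTransportOp E v c n hcδ₁ hδ₁ hd₁ hcδ₂ hδ₂ hd₂ x T₀ hT₀ hT₀d hx) (MpPsi.toRep (localSchrodinger F n T₀ v) (undoubleLoc F E c v n hJ hJD hcδ₁ hδ₁ hd₁ hT₀ hT₀d s hs g)
            ((lineTransportOp E v c n hcδ₁ hδ₁ hd₁ hcδ₂ hδ₂ hd₂ x T₀ hT₀ hT₀d hx).symm f₁))) f₂ := by
      rw [boxEquivSB_boxSB, LinearEquiv.apply_symm_apply]

/-- **UNDOUBLING COMMUTES WITH THE LINE-ISOMETRY CONJUGATION.**  Let `s : H(F_v) →* S̃p_{ψ_v}(𝕎^𝔻_v)` lie over `ι^𝔻_{δ₁}`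
and let `P ∈ S̃p_{ψ_v}(𝕎^𝔻_v)` be ANY element over the transport `γ_x^𝔻` (`δ₂ ⊗ 1 = x xᶜ (δ₁ ⊗ 1)`).  Then the conjugate
`P s P⁻¹` lies over `ι^𝔻_{δ₂}` (`proj_conj_comp_eq_iota` of `LocalLineIsometryRigidity`) and its undoubling IS the line-transported undoubling of `s`:
`undoubleLoc (P s P⁻¹) = q_x (undoubleLoc s) q_x⁻¹ = lineTransportSplitting x (undoubleLoc s)`.  (Projections: both lie over
`ι_{δ₂}`; operators: `⊠ f₂`-cancellation in `toRep_conj_inlLoc_boxSB`.)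
[cite: GelbartRogawski1991, §3.1 Prop. 3.1.1 p. 455, Remark p. 457 L4–13] [cite: MoeglinVignerasWaldspurger1987, Chap. 2 II.1 Rem. (6); Chap. 3 I.1–I.3] -/
theorem undoubleLoc_conj_eq_lineTransportSplitting (hJ : J = T₀.map (algebraMap F E))
    (hJD : JD = (gramD F n T₀).map (algebraMap F E)) (hT₀ : T₀.IsSymm) (hT₀d : IsUnit T₀.det)
    (hx : algebraMap E (LocalRing E v) δ₂ = (x : LocalRing E v) * conjLocal E c v x * algebraMap E (LocalRing E v) δ₁)
    (s : UnitaryGroup.localPi E c (n + n) JD v →* LocalMp F (n + n) (gramD F n T₀) v)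
    (hs : ∀ h, MpPsi.proj _ (s h) = iota F E c (n + n) hcδ₁ hδ₁ hd₁ (gramD F n T₀) (gramD_isSymm F n hT₀) hJD v h)
    (P : LocalMp F (n + n) (gramD F n T₀) v)
    (hP : MpPsi.proj _ P = transportSp E v c (n + n) hcδ₁ hδ₁ hd₁ hcδ₂ hδ₂ hd₂ x (gramD F n T₀) (gramD_isSymm F n hT₀) hx)
    (hs' : ∀ h, MpPsi.proj _ (((MulAut.conj P).toMonoidHom.comp s) h) =
      iota F E c (n + n) hcδ₂ hδ₂ hd₂ (gramD F n T₀) (gramD_isSymm F n hT₀) hJD v h) :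
    undoubleLoc F E c v n hJ hJD hcδ₂ hδ₂ hd₂ hT₀ hT₀d ((MulAut.conj P).toMonoidHom.comp s) hs' =
      lineTransportSplitting E v c n hcδ₁ hδ₁ hd₁ hcδ₂ hδ₂ hd₂ x T₀ hT₀ hT₀d hx
        (undoubleLoc F E c v n hJ hJD hcδ₁ hδ₁ hd₁ hT₀ hT₀d s hs) := by
  refine MonoidHom.ext fun g => MpPsi.ext_of_proj_of_toOp ?_ ?_
  · -- both lie over `ι_{δ₂}(g)`
    exact (proj_undoubleLoc F E c v n hJ hJD hcδ₂ hδ₂ hd₂ hT₀ hT₀d _ hs' g).trans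
      (proj_lineTransportSplitting E v c n hcδ₁ hδ₁ hd₁ hcδ₂ hδ₂ hd₂ x T₀ hT₀ hT₀d hJ hx _
        (proj_undoubleLoc F E c v n hJ hJD hcδ₁ hδ₁ hd₁ hT₀ hT₀d s hs) g).symm
  · -- operators: test against `f₁ ⊠ f₂`, `f₂ ≠ 0`
    obtain ⟨f₂, hf₂⟩ := exists_schwartzBruhat_pi_ne_zero (v.adicCompletion F) (Fin n)
    refine LinearEquiv.ext fun f₁ => boxSB_left_cancel (v.adicCompletion F) (e₂ n) hf₂ ?_
    have hU₁ := implementerUniqueUpToScalar_localSchrodinger F n T₀ hT₀d v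
    -- `ω(undoubleLoc (P s P⁻¹) g) f₁ ⊠ f₂ = ω(P s(g ⊕ 1) P⁻¹)(f₁ ⊠ f₂) = (M_x ω(undoubleLoc s g) M_x⁻¹ f₁) ⊠ f₂`
    have key : boxSB (v.adicCompletion F) (e₂ n) (MpPsi.toRep (localSchrodinger F n T₀ v)
          (undoubleLoc F E c v n hJ hJD hcδ₂ hδ₂ hd₂ hT₀ hT₀d ((MulAut.conj P).toMonoidHom.comp s) hs' g) f₁) f₂ =
        boxSB (v.adicCompletion F) (e₂ n) (MpPsi.toRep (localSchrodinger F n T₀ v)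
          (lineTransportSplitting E v c n hcδ₁ hδ₁ hd₁ hcδ₂ hδ₂ hd₂ x T₀ hT₀ hT₀d hx
            (undoubleLoc F E c v n hJ hJD hcδ₁ hδ₁ hd₁ hT₀ hT₀d s hs) g) f₁) f₂ :=
      calc boxSB (v.adicCompletion F) (e₂ n) (MpPsi.toRep (localSchrodinger F n T₀ v)
            (undoubleLoc F E c v n hJ hJD hcδ₂ hδ₂ hd₂ hT₀ hT₀d ((MulAut.conj P).toMonoidHom.comp s) hs' g) f₁) f₂
          = MpPsi.toRep (localSchrodinger F (n + n) (gramD F n T₀) v)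
              (((MulAut.conj P).toMonoidHom.comp s) (inlLoc F E c v n hJ hJD g)) (boxSB (v.adicCompletion F) (e₂ n) f₁ f₂) :=
          (toRep_undoubleLoc_boxSB F E c v n hJ hJD hcδ₂ hδ₂ hd₂ hT₀ hT₀d _ hs' g f₁ f₂).symm
        _ = boxSB (v.adicCompletion F) (e₂ n) ((lineTransportOp E v c n hcδ₁ hδ₁ hd₁ hcδ₂ hδ₂ hd₂ x T₀ hT₀ hT₀d hx) (MpPsi.toRep (localSchrodinger F n T₀ v)
              (undoubleLoc F E c v n hJ hJD hcδ₁ hδ₁ hd₁ hT₀ hT₀d s hs g) ((lineTransportOp E v c n hcδ₁ hδ₁ hd₁ hcδ₂ hδ₂ hd₂ x T₀ hT₀ hT₀d hx).symm f₁))) f₂ :=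
          toRep_conj_inlLoc_boxSB F E c v hcδ₁ hδ₁ hd₁ hcδ₂ hδ₂ hd₂ x n hJ hJD hT₀ hT₀d hx s hs P hP g f₁ f₂
        _ = boxSB (v.adicCompletion F) (e₂ n) (MpPsi.toRep (localSchrodinger F n T₀ v)
              (lineTransportLift E v c n hcδ₁ hδ₁ hd₁ hcδ₂ hδ₂ hd₂ x T₀ hT₀ hT₀d hx *
                  undoubleLoc F E c v n hJ hJD hcδ₁ hδ₁ hd₁ hT₀ hT₀d s hs g *
                (lineTransportLift E v c n hcδ₁ hδ₁ hd₁ hcδ₂ hδ₂ hd₂ x T₀ hT₀ hT₀d hx)⁻¹) f₁) f₂ :=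
          congrArg (fun y => boxSB (v.adicCompletion F) (e₂ n) y f₂)
            (MpPsi.toRep_conj_eq_of_implements _ hU₁
              (lineTransportLift E v c n hcδ₁ hδ₁ hd₁ hcδ₂ hδ₂ hd₂ x T₀ hT₀ hT₀d hx) _ (lineTransportOp E v c n hcδ₁ hδ₁ hd₁ hcδ₂ hδ₂ hd₂ x T₀ hT₀ hT₀d hx)
              (MpPsi.toRep_implements _ (lineTransportLift E v c n hcδ₁ hδ₁ hd₁ hcδ₂ hδ₂ hd₂ x T₀ hT₀ hT₀d hx)) f₁).symm
        _ = boxSB (v.adicCompletion F) (e₂ n) (MpPsi.toRep (localSchrodinger F n T₀ v)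
              (lineTransportSplitting E v c n hcδ₁ hδ₁ hd₁ hcδ₂ hδ₂ hd₂ x T₀ hT₀ hT₀d hx
                (undoubleLoc F E c v n hJ hJD hcδ₁ hδ₁ hd₁ hT₀ hT₀d s hs) g) f₁) f₂ := rfl
    exact key

end Main

end Literature.NumberTheory.GelbartRogawski1991.UnitaryDualPair.LocalSplitting

end
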